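import Mathlib
import HarnessLib
import Summits.HubbardSuperconductivity.HubbardSuperconductivity.Theorems.KLProgrammeKLRegimeSplitTwoLegSizesMSChainFrames
import Summits.HubbardSuperconductivity.HubbardSuperconductivity.Theorems.KLProgrammeKLRegimeSplitCounterMap

/-!
# Route `KLProgramme`, crux K3 — gen-5 ENGINE child (stmt-…-19918, `stub_twoLeg_step`, clause `TwoLegSizesMST`), recipe (L)+(F):
# SIZES OF THE CHAIN FRAMES ((P4-c), step 2): `‖Dʲ evalM (msBase …)‖`, `‖Dʲ evalM (msChain … k)‖` and `‖Dʲ frameShift (msChain … k)‖` as SUMS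
# of the sizes of the coarse pieces, the constant, the low parts and the high parts

Seat hubbard-kl-k3c3-p1 (g3).  Pure bookkeeping over `fadd` / `fsumR` / `fsumIoc` (`evalM` is additive, `iteratedFDeriv` is additive on `C^∞`
functions): the inputs of P2-INTERFACE §1 (size-keyed towers of the chain frames) are reduced to per-piece sizes, which `…TwoLegSizesMSPieceParts`
supplies (`anchorSize`, contraction / Jackson / Bernstein forms).  Proofs only; nothing about the model.
-/

noncomputable section

namespace Summit.HubbardSuperconductivity.HubbardSuperconductivity.Theorems.KLRegimeSplit

set_option linter.dupNamespace false -- summit = problem name (single-conjunct summit), D-0017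

open Real Finset Literature.MathematicalPhysics.QuantumLattice
open Summit.HubbardSuperconductivity.HubbardSuperconductivity.Theorems.DispersionFlow

/-- `evalM (A ⊕ B) = evalM A + evalM B`. -/
theorem evalM_fadd (A B : TrigPolyC4v) : evalM (fadd A B) = fun q => evalM A q + evalM B q := by
  funext q; simp [evalM, eval_fadd]

/-- **Additivity of the sizes**: `‖Dʲ evalM (A ⊕ B)‖ ≤ ‖Dʲ evalM A‖ + ‖Dʲ evalM B‖`. -/
theorem norm_iteratedFDeriv_evalM_fadd_le (A B : TrigPolyC4v) (j : ℕ) (q : Momentum) :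
    ‖iteratedFDeriv ℝ j (evalM (fadd A B)) q‖ ≤ ‖iteratedFDeriv ℝ j (evalM A) q‖ + ‖iteratedFDeriv ℝ j (evalM B) q‖ := by
  rw [evalM_fadd, show (fun q => evalM A q + evalM B q) = evalM A + evalM B from rfl,
    iteratedFDeriv_add_apply ((contDiff_evalM A).contDiffAt) ((contDiff_evalM B).contDiffAt)]
  exact norm_add_le _ _

/-- `‖Dʲ evalM (Σ_{i<k} f i)‖ ≤ Σ_{i<k} ‖Dʲ evalM (f i)‖`. -/
theorem norm_iteratedFDeriv_evalM_fsumR_le (f : ℕ → TrigPolyC4v) (k j : ℕ) (q : Momentum) :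
    ‖iteratedFDeriv ℝ j (evalM (fsumR f k)) q‖ ≤ ∑ i ∈ range k, ‖iteratedFDeriv ℝ j (evalM (f i)) q‖ := by
  induction k with
  | zero =>
    simp only [fsumR, range_zero, sum_empty]
    rw [show evalM (0 : TrigPolyC4v) = fun _ => (0 : ℝ) from funext fun q => by simp [evalM]]
    rcases Nat.eq_zero_or_pos j with rfl | hj
    · simp
    · rw [iteratedFDeriv_const_of_ne (by omega)]; simp
  | succ k ih =>
    rw [fsumR, sum_range_succ]
    exact (norm_iteratedFDeriv_evalM_fadd_le _ _ j q).trans (by linarith)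

/-- `‖Dʲ evalM (Σ_{m ∈ Ioc n N} f m)‖ ≤ Σ_{m ∈ Ioc n N} ‖Dʲ evalM (f m)‖` (`n ≤ N`). -/
theorem norm_iteratedFDeriv_evalM_fsumIoc_le (f : ℕ → TrigPolyC4v) {n N : ℕ} (hnN : n ≤ N) (j : ℕ) (q : Momentum) :
    ‖iteratedFDeriv ℝ j (evalM (fsumIoc f n N)) q‖ ≤ ∑ m ∈ Ioc n N, ‖iteratedFDeriv ℝ j (evalM (f m)) q‖ := by
  rw [fsumIoc, (show Ioc n N = Ico (n + 1) (N + 1) by ext m; simp only [Finset.mem_Ioc, Finset.mem_Ico]; omega),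
    Finset.sum_Ico_eq_sum_range, show N + 1 - (n + 1) = N - n by omega]
  exact norm_iteratedFDeriv_evalM_fsumR_le _ _ j q

/-- The constant frame: `‖D⁰‖ = |c|`, `‖Dʲ‖ = 0` for `j ≥ 1`; in one line `≤ [j=0]·|c|`. -/
theorem norm_iteratedFDeriv_evalM_msConst_le (c : ℝ) (j : ℕ) (q : Momentum) :
    ‖iteratedFDeriv ℝ j (evalM (msConst c)) q‖ ≤ if j = 0 then |c| else 0 := by
  rw [show evalM (msConst c) = fun _ => c from funext fun q => by simp [evalM]]
  rcases Nat.eq_zero_or_pos j with rfl | hj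
  · simp
  · rw [iteratedFDeriv_const_of_ne (by omega), if_neg (by omega)]; simp

/-- **Sizes of the BASE frame** as sums. -/
theorem norm_iteratedFDeriv_evalM_msBase_le (d : ℕ) (Kp : ℕ → TrigPolyC4v) {n N : ℕ} (hnN : n ≤ N) (j : ℕ) (q : Momentum) :
    ‖iteratedFDeriv ℝ j (evalM (msBase d Kp n N)) q‖ ≤
      ∑ m ∈ range (n + 1), ‖iteratedFDeriv ℝ j (evalM (Kp m)) q‖ + (if j = 0 then |∑ m ∈ Ioc n N, (Kp m).eval 0| else 0) +
        ∑ m ∈ Ioc n N, ‖iteratedFDeriv ℝ j (evalM (lowPart d (Kp m))) q‖ := by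
  rw [msBase]
  refine (norm_iteratedFDeriv_evalM_fadd_le _ _ j q).trans (add_le_add ((norm_iteratedFDeriv_evalM_fadd_le _ _ j q).trans
    (add_le_add (norm_iteratedFDeriv_evalM_fsumR_le _ _ j q) (norm_iteratedFDeriv_evalM_msConst_le _ j q)))
    (norm_iteratedFDeriv_evalM_fsumIoc_le _ hnN j q))

/-- **Sizes along the CHAIN** as sums. -/
theorem norm_iteratedFDeriv_evalM_msChain_le (d : ℕ) (Kp : ℕ → TrigPolyC4v) {n N : ℕ} (hnN : n ≤ N) (k j : ℕ) (q : Momentum) :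
    ‖iteratedFDeriv ℝ j (evalM (msChain d Kp n N k)) q‖ ≤
      (∑ m ∈ range (n + 1), ‖iteratedFDeriv ℝ j (evalM (Kp m)) q‖ + (if j = 0 then |∑ m ∈ Ioc n N, (Kp m).eval 0| else 0) +
        ∑ m ∈ Ioc n N, ‖iteratedFDeriv ℝ j (evalM (lowPart d (Kp m))) q‖) +
      ∑ m ∈ Ioc n (n + k), ‖iteratedFDeriv ℝ j (evalM (highPart d (Kp m))) q‖ := by
  rw [msChain]
  exact (norm_iteratedFDeriv_evalM_fadd_le _ _ j q).trans
    (add_le_add (norm_iteratedFDeriv_evalM_msBase_le d Kp hnN j q) (norm_iteratedFDeriv_evalM_fsumIoc_le _ (by omega) j q))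

/-- `frameShift C = −evalM C`, so its sizes are those of `evalM C`. -/
theorem norm_iteratedFDeriv_frameShift_eq (C : TrigPolyC4v) (j : ℕ) (q : Momentum) :
    ‖iteratedFDeriv ℝ j (frameShift C) q‖ = ‖iteratedFDeriv ℝ j (evalM C) q‖ := by
  rw [show frameShift C = -evalM C from funext fun q => rfl, iteratedFDeriv_neg_apply, norm_neg]

/-- **Sizes of the chain frames in the `frameShift` key of P2-INTERFACE §1.** -/
theorem norm_iteratedFDeriv_frameShift_msChain_le (d : ℕ) (Kp : ℕ → TrigPolyC4v) {n N : ℕ} (hnN : n ≤ N) (k j : ℕ) (q : Momentum) :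
    ‖iteratedFDeriv ℝ j (frameShift (msChain d Kp n N k)) q‖ ≤
      (∑ m ∈ range (n + 1), ‖iteratedFDeriv ℝ j (evalM (Kp m)) q‖ + (if j = 0 then |∑ m ∈ Ioc n N, (Kp m).eval 0| else 0) +
        ∑ m ∈ Ioc n N, ‖iteratedFDeriv ℝ j (evalM (lowPart d (Kp m))) q‖) +
      ∑ m ∈ Ioc n (n + k), ‖iteratedFDeriv ℝ j (evalM (highPart d (Kp m))) q‖ := by
  rw [norm_iteratedFDeriv_frameShift_eq]
  exact norm_iteratedFDeriv_evalM_msChain_le d Kp hnN k j q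

end Summit.HubbardSuperconductivity.HubbardSuperconductivity.Theorems.KLRegimeSplit

end
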